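import Summits.HodgeConjecture.HodgeConjecture.Theorems.K2E3BlockRadicalRayLevels
import Summits.HodgeConjecture.HodgeConjecture.Theorems.K2E3WittCoweightRatios
import Literature.NumberTheory.Automorphic.JacquetCuspidalCompactCoefficientsCone
import HarnessLib

/-!
# The contraction data of the Witt cone of a quasi-split unitary group (crux H413, row 13a, organ J1 assembled)

Over a field `K` with a valuative relation, an involution `σ`, and the Witt form `wittFormOn e Han = Φ_N` in a STANDARD indexing `e`
(`e_1 … e_r ∣ anisotropic kernel ∣ f_r … f_1`; so `m ≤ 1`), the `r` Witt cocharacters `a_α = wittCocharacter σ hσ e Han α ϖ` (`α : Fin r`) and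
the block ray levels

  `Nf α j = a_α^{-j} (K_γ ∩ N ∩ U_{c_α}) a_α^{j}`,  `c_α = wittBlockOn e (univ.erase α)` the labelling of the MAXIMAL parabolic of `α`,

(`K_γ` the principal congruence subgroup, `N` the upper unitriangular radical of the Borel, `U_{c_α}` ★ `unipotentRadicalGL`) supply every
contraction binder of the tree's cone criterion ★ `Representation.isSupercuspidal_of_subsingleton_coinvariants_of_cartan_pi`
(`JacquetCuspidalCompactCoefficientsCone`):

* §1 `commute_wittCocharacterGL`, `commute_wittCocharacter` (`hcomm`: diagonal elements commute); `comap_unipotentRadicalGL_le_unipotentU`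
  (a block radical for a MONOTONE labelling lies in the Borel radical), `wittRadical_le_borelN`, `borelN_inf_wittRadical_eq`
  (`N ∩ U_{c_S} = N_S = (standardParabolicTriple σ e Han S).N`).
* §2 `wittRayLevel_mono` (`hmono`), `conj_mem_wittRayLevel` (`hcontr`), `conj_mem_wittRayLevel_of_commute` (`hpres`), `exists_mem_wittRayLevel` (`hexh`,
  stated on `(standardParabolicTriple σ e Han (univ.erase α)).N`), `exists_wittRayLevel_subset` (`hsmall`) — ★ `K2E3BlockRadicalRayLevels` fed with the
  coweight ratios ★ `K2E3WittCoweightRatios` (`≤ 1` along positions, `≤ |ϖ|` across the break of the maximal parabolic).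
* §3 **`isSupercuspidal_of_subsingleton_coinvariants_of_wittCartan`**: a smooth representation of `U(σ, Φ_N)(K)` (`K` a non-archimedean local field)
  whose Jacquet modules along the `r` maximal standard parabolics vanish is supercuspidal — GIVEN the Cartan decomposition over the Witt cone
  `U = K₀ · {∏_α a_α^{n_α}} · K₀ · Z(U)`, `K₀ = U ∩ GL_N(𝒪)` (the one remaining input, hypothesis `hcartan`; ★ for `r = 1`:
  `UnitaryGroup.exists_cartan_of_involution`).

HONEST LABEL: structure lemmas + an implication; HC_CM is proved only modulo the 7 printed citations (2 remaining named inputs: hLiu418 =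
stmt-HodgeConjecture-24832, h413 = stmt-HodgeConjecture-24833) until rung 0 closes.

References: W. Casselman (1995), Prop. 1.4.4, Thm. 5.3.1; I. N. Bernstein, A. V. Zelevinsky (1976) §3.18–3.21, (1977) §1.9, §2.1; A. Borel (1991) §23.
-/

set_option autoImplicit false
set_option linter.dupNamespace false

open scoped MatrixGroups Pointwise Topology
open ValuativeRel Matrix

namespace Summit.HodgeConjecture.HodgeConjecture.Cruxes.H413.K2E3WittConeContraction

open Literature.NumberTheory.Automorphic Literature.NumberTheory.Automorphic.UnitaryGroup
open K2E3LocalUnitaryWitt K2E3WittStandardIndexing K2E3WittCoweightRatios K2E3BlockRadicalRayLevels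

/-! ## §1 Commuting cocharacters; block radicals inside the Borel radical -/

section Alg

variable {R : Type*} [CommRing R] (σ : R →+* R) {N r m : ℕ} (e : WittIndex r m ≃ Fin N)

/-- **The Witt cocharacters commute** (they are diagonal: `glDiagonal` is a monoid hom out of a commutative group). [cite: Borel1991, §23] -/
theorem commute_wittCocharacterGL (α β : Fin r) (ϖ ϖ' : Rˣ) : Commute (wittCocharacterGL σ e α ϖ) (wittCocharacterGL σ e β ϖ') := by
  unfold wittCocharacterGL
  rw [Commute, SemiconjBy, ← map_mul, ← map_mul, mul_comm]

/-- Elements of `U(σ, J)` commute when their underlying invertible matrices do. [folklore] -/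
theorem commute_of_coe_commute {J : Matrix (Fin N) (Fin N) R} (t t' : ↥(unitaryGroupOfForm σ J))
    (h : Commute ((t : ↥(unitaryGroupOfForm σ J)) : GL (Fin N) R) ((t' : ↥(unitaryGroupOfForm σ J)) : GL (Fin N) R)) : Commute t t' :=
  Subtype.ext (by rw [Subgroup.coe_mul, Subgroup.coe_mul]; exact h.eq)

/-- **The Witt cocharacters `a_α(ϖ), a_β(ϖ') ∈ U(σ, W)` commute** (`hcomm` of the cone criterion). [cite: Borel1991, §23] [cite: Casselman1995, Thm. 5.3.1] -/
theorem commute_wittCocharacter (hσ : ∀ a, σ (σ a) = a) (Han : Matrix (Fin m) (Fin m) R) (α β : Fin r) (ϖ ϖ' : Rˣ) :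
    Commute (wittCocharacter σ hσ e Han α ϖ) (wittCocharacter σ hσ e Han β ϖ') :=
  commute_of_coe_commute σ _ _ (commute_wittCocharacterGL σ e α β ϖ ϖ')

/-- The underlying invertible matrix of `a_α(ϖ)` is `glDiagonal` of the coweight (`rfl`). [cite: Borel1991, §23] -/
theorem coe_wittCocharacter_eq_glDiagonal (hσ : ∀ a, σ (σ a) = a) (Han : Matrix (Fin m) (Fin m) R) (ϖ : Rˣ) (α : Fin r) :
    ((wittCocharacter σ hσ e Han α ϖ : ↥(unitaryGroupOfForm σ (wittFormOn e Han))) : GL (Fin N) R) =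
      glDiagonal N R (fun k => wittCoweight σ α ϖ (e.symm k)) := rfl

/-- **A block radical for a monotone labelling lies in the upper unitriangular radical**: `U ∩ U_c ≤ N` for `c : Fin N → α'` monotone (below the
diagonal `c j ≤ c i`: across blocks the entry vanishes by block-triangularity, inside a block it is an off-diagonal entry of `1`).
[cite: BernsteinZelevinsky1977, §2.1] -/
theorem comap_unipotentRadicalGL_le_unipotentU (J : Matrix (Fin N) (Fin N) R) {α' : Type*} [LinearOrder α'] (c : Fin N → α') (hcm : Monotone c) :
    (unipotentRadicalGL R c).comap (unitaryGroupOfForm σ J).subtype ≤ unipotentU σ J := by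
  intro x hx
  have hx' : ((x : ↥(unitaryGroupOfForm σ J)) : GL (Fin N) R) ∈ unipotentRadicalGL R c := hx
  obtain ⟨htri, hdiag⟩ := (mem_unipotentRadicalGL_iff_entry c _).1 hx'
  refine (mem_unipotentU_iff x).2 ⟨fun i j hij => ?_, fun i => by rw [hdiag i i rfl, Matrix.one_apply_eq]⟩
  rcases (hcm (le_of_lt hij)).lt_or_eq with hc | hc
  · exact htri hc
  · rw [hdiag i j hc.symm]
    exact Matrix.one_apply_ne (ne_of_lt hij).symm

/-- **`N_S ≤ N`**: in a standard indexing the radical of the standard parabolic `P_S` lies in the Borel radical (`wittBlockOn e S` is monotone,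
★ `monotone_wittBlockOn_of_std`). [cite: Borel1991, §23] [cite: BernsteinZelevinsky1977, §2.1] -/
theorem wittRadical_le_unipotentU (hstd : ∀ x, (e x).val = Sum.elim (fun i : Fin r => i.val)
      (Sum.elim (fun u : Fin m => r + u.val) (fun j : Fin r => r + m + j.val)) x)
    (J : Matrix (Fin N) (Fin N) R) (S : Finset (Fin r)) : wittRadical σ J e S ≤ unipotentU σ J :=
  comap_unipotentRadicalGL_le_unipotentU σ J (wittBlockOn e S) (monotone_wittBlockOn_of_std e hstd S)

/-- **`N ∩ (U ∩ U_{c_S}) = N_S = (standardParabolicTriple σ e Han S).N`** for the Borel triple of `Φ_N = wittFormOn e Han` (standard indexing).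
[cite: Borel1991, §23] [cite: BernsteinZelevinsky1977, §2.1] -/
theorem borelN_inf_wittRadical_eq (hstd : ∀ x, (e x).val = Sum.elim (fun i : Fin r => i.val)
      (Sum.elim (fun u : Fin m => r + u.val) (fun j : Fin r => r + m + j.val)) x)
    (Han : Matrix (Fin m) (Fin m) R) (hJ : wittFormOn e Han = (StdForm.antidiagonal N).over R) (S : Finset (Fin r)) :
    (borelTriple σ (wittFormOn e Han) hJ).N ⊓ (unipotentRadicalGL R (wittBlockOn e S)).comap (unitaryGroupOfForm σ (wittFormOn e Han)).subtype =
      (standardParabolicTriple σ e Han S).N :=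
  inf_eq_right.2 (wittRadical_le_unipotentU σ e hstd (wittFormOn e Han) S)

end Alg

/-! ## §2 The block ray levels of a Witt cocharacter: `hmono`, `hcontr`, `hpres`, `hexh`, `hsmall` -/

section Ray

variable {K : Type*} [Field K] [ValuativeRel K] (σ : K →+* K) (hσ : ∀ a, σ (σ a) = a) {N r m : ℕ} (e : WittIndex r m ≃ Fin N)
  (hstd : ∀ x, (e x).val = Sum.elim (fun i : Fin r => i.val) (Sum.elim (fun u : Fin m => r + u.val) (fun j : Fin r => r + m + j.val)) x)
  (Han : Matrix (Fin m) (Fin m) K) (hJ : wittFormOn e Han = (StdForm.antidiagonal N).over K)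
  (ϖ : Kˣ) (hϖ1 : valuation K (ϖ : K) ≤ 1) (hσϖ : valuation K (σ ϖ) = valuation K (ϖ : K))

include hstd hϖ1 hσϖ in
/-- **`hmono`: the block ray levels of `a_α(ϖ)` increase**, `a_α^{-j}(K_γ ∩ N ∩ U_{c_α})a_α^{j} ≤ a_α^{-(j+1)}(…)a_α^{j+1}`
(coweight ratios `≤ 1` along positions). [cite: BernsteinZelevinsky1976, §3.18–3.21] [cite: Casselman1995, Prop. 1.4.4] -/
theorem wittRayLevel_mono {γ : ValueGroupWithZero K} (hγ : γ < 1) (α : Fin r) (j : ℤ) :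
    ((congruenceGL N γ).comap (unitaryGroupOfForm σ (wittFormOn e Han)).subtype ⊓ (borelTriple σ (wittFormOn e Han) hJ).N ⊓
        (unipotentRadicalGL K (wittBlockOn e (Finset.univ.erase α))).comap (unitaryGroupOfForm σ (wittFormOn e Han)).subtype).map
        (MulAut.conj (wittCocharacter σ hσ e Han α ϖ ^ (-j))).toMonoidHom ≤
      ((congruenceGL N γ).comap (unitaryGroupOfForm σ (wittFormOn e Han)).subtype ⊓ (borelTriple σ (wittFormOn e Han) hJ).N ⊓
        (unipotentRadicalGL K (wittBlockOn e (Finset.univ.erase α))).comap (unitaryGroupOfForm σ (wittFormOn e Han)).subtype).map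
        (MulAut.conj (wittCocharacter σ hσ e Han α ϖ ^ (-(j + 1)))).toMonoidHom :=
  blockRayLevel_mono σ hJ (wittBlockOn e (Finset.univ.erase α)) (monotone_wittBlockOn_of_std e hstd _) hγ _ _
    (coe_wittCocharacter_eq_glDiagonal σ e hσ Han ϖ α) (fun i j hij => valuation_wittCoweight_ratio_le_one_of_lt σ α ϖ hϖ1 hσϖ e hstd i j hij) j

/-- **`hcontr`: `a_α(ϖ)` contracts its block ray levels** (re-bracketing). [cite: BernsteinZelevinsky1976, §3.18–3.21] -/
theorem conj_mem_wittRayLevel {γ : ValueGroupWithZero K} (α : Fin r) (j : ℤ) {u : ↥(unitaryGroupOfForm σ (wittFormOn e Han))}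
    (hu : u ∈ ((congruenceGL N γ).comap (unitaryGroupOfForm σ (wittFormOn e Han)).subtype ⊓ (borelTriple σ (wittFormOn e Han) hJ).N ⊓
        (unipotentRadicalGL K (wittBlockOn e (Finset.univ.erase α))).comap (unitaryGroupOfForm σ (wittFormOn e Han)).subtype).map
        (MulAut.conj (wittCocharacter σ hσ e Han α ϖ ^ (-(j + 1)))).toMonoidHom) :
    wittCocharacter σ hσ e Han α ϖ * u * (wittCocharacter σ hσ e Han α ϖ)⁻¹ ∈
      ((congruenceGL N γ).comap (unitaryGroupOfForm σ (wittFormOn e Han)).subtype ⊓ (borelTriple σ (wittFormOn e Han) hJ).N ⊓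
        (unipotentRadicalGL K (wittBlockOn e (Finset.univ.erase α))).comap (unitaryGroupOfForm σ (wittFormOn e Han)).subtype).map
        (MulAut.conj (wittCocharacter σ hσ e Han α ϖ ^ (-j))).toMonoidHom :=
  conj_mem_blockRayLevel σ hJ (wittBlockOn e (Finset.univ.erase α)) _ j hu

include hstd hϖ1 hσϖ in
/-- **`hpres`: `a_β(ϖ)` preserves the block ray levels of `a_α(ϖ)`** (they commute; the coweight ratios of `β` are `≤ 1` along positions).
[cite: Casselman1995, Prop. 1.4.4; Thm. 5.3.1] -/
theorem conj_mem_wittRayLevel_of_commute {γ : ValueGroupWithZero K} (hγ : γ < 1) (α β : Fin r) (j : ℤ)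
    {u : ↥(unitaryGroupOfForm σ (wittFormOn e Han))}
    (hu : u ∈ ((congruenceGL N γ).comap (unitaryGroupOfForm σ (wittFormOn e Han)).subtype ⊓ (borelTriple σ (wittFormOn e Han) hJ).N ⊓
        (unipotentRadicalGL K (wittBlockOn e (Finset.univ.erase α))).comap (unitaryGroupOfForm σ (wittFormOn e Han)).subtype).map
        (MulAut.conj (wittCocharacter σ hσ e Han α ϖ ^ (-j))).toMonoidHom) :
    wittCocharacter σ hσ e Han β ϖ * u * (wittCocharacter σ hσ e Han β ϖ)⁻¹ ∈
      ((congruenceGL N γ).comap (unitaryGroupOfForm σ (wittFormOn e Han)).subtype ⊓ (borelTriple σ (wittFormOn e Han) hJ).N ⊓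
        (unipotentRadicalGL K (wittBlockOn e (Finset.univ.erase α))).comap (unitaryGroupOfForm σ (wittFormOn e Han)).subtype).map
        (MulAut.conj (wittCocharacter σ hσ e Han α ϖ ^ (-j))).toMonoidHom :=
  conj_mem_blockRayLevel_of_ratio_le_one σ hJ (wittBlockOn e (Finset.univ.erase α)) (monotone_wittBlockOn_of_std e hstd _) hγ _ _
    (commute_wittCocharacter σ e hσ Han α β ϖ ϖ) _ (coe_wittCocharacter_eq_glDiagonal σ e hσ Han ϖ β)
    (fun i j hij => valuation_wittCoweight_ratio_le_one_of_lt σ β ϖ hϖ1 hσϖ e hstd i j hij) j hu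

end Ray

section RayTop

variable {K : Type*} [Field K] [ValuativeRel K] [TopologicalSpace K] [IsNonarchimedeanLocalField K]
  (σ : K →+* K) (hσ : ∀ a, σ (σ a) = a) {N r m : ℕ} (e : WittIndex r m ≃ Fin N)
  (hstd : ∀ x, (e x).val = Sum.elim (fun i : Fin r => i.val) (Sum.elim (fun u : Fin m => r + u.val) (fun j : Fin r => r + m + j.val)) x)
  (Han : Matrix (Fin m) (Fin m) K) (hJ : wittFormOn e Han = (StdForm.antidiagonal N).over K)
  (ϖ : Kˣ) (hϖ : valuation K (ϖ : K) < 1) (hσϖ : valuation K (σ ϖ) = valuation K (ϖ : K))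

include hstd hϖ hσϖ in
/-- **`hexh`: the block ray levels of `a_α(ϖ)` exhaust the radical `N_α = (standardParabolicTriple σ e Han (univ.erase α)).N`** of the maximal
parabolic of `α` (`0 < |ϖ| < 1`; across the break the coweight contracts by `|ϖ|`; `N_α ≤ N`). [cite: BernsteinZelevinsky1977, §1.9]
[cite: Casselman1995, proof of Thm. 5.3.1] -/
theorem exists_mem_wittRayLevel {γ : ValueGroupWithZero K} (hγ0 : γ ≠ 0) (hγ : γ < 1) (α : Fin r)
    {u : ↥(unitaryGroupOfForm σ (wittFormOn e Han))} (hu : u ∈ (standardParabolicTriple σ e Han (Finset.univ.erase α)).N) :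
    ∃ j : ℤ, u ∈ ((congruenceGL N γ).comap (unitaryGroupOfForm σ (wittFormOn e Han)).subtype ⊓ (borelTriple σ (wittFormOn e Han) hJ).N ⊓
        (unipotentRadicalGL K (wittBlockOn e (Finset.univ.erase α))).comap (unitaryGroupOfForm σ (wittFormOn e Han)).subtype).map
        (MulAut.conj (wittCocharacter σ hσ e Han α ϖ ^ (-j))).toMonoidHom :=
  exists_mem_blockRayLevel σ hJ (wittBlockOn e (Finset.univ.erase α)) (monotone_wittBlockOn_of_std e hstd _)
    ((Valuation.ne_zero_iff _).2 (Units.ne_zero ϖ)) hϖ hγ0 hγ _ _ (coe_wittCocharacter_eq_glDiagonal σ e hσ Han ϖ α)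
    (fun i j _ hc => valuation_wittCoweight_ratio_le_of_label_lt σ α ϖ hϖ.le hσϖ e i j hc)
    (wittRadical_le_unipotentU σ e hstd (wittFormOn e Han) _ hu) hu

include hstd hϖ hσϖ in
/-- **`hsmall`: the block ray levels of `a_α(ϖ)` shrink to `1`**: every neighbourhood of `1` in `U` contains one of them.
[cite: BernsteinZelevinsky1976, §3.18–3.21] [cite: Casselman1995, Prop. 1.4.4] -/
theorem exists_wittRayLevel_subset {γ : ValueGroupWithZero K} (hγ0 : γ ≠ 0) (hγ : γ < 1) (α : Fin r)
    {O : Set ↥(unitaryGroupOfForm σ (wittFormOn e Han))} (hO : O ∈ 𝓝 (1 : ↥(unitaryGroupOfForm σ (wittFormOn e Han)))) :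
    ∃ j : ℤ, ((((congruenceGL N γ).comap (unitaryGroupOfForm σ (wittFormOn e Han)).subtype ⊓ (borelTriple σ (wittFormOn e Han) hJ).N ⊓
        (unipotentRadicalGL K (wittBlockOn e (Finset.univ.erase α))).comap (unitaryGroupOfForm σ (wittFormOn e Han)).subtype).map
        (MulAut.conj (wittCocharacter σ hσ e Han α ϖ ^ (-j))).toMonoidHom : Subgroup ↥(unitaryGroupOfForm σ (wittFormOn e Han))) :
          Set ↥(unitaryGroupOfForm σ (wittFormOn e Han))) ⊆ O :=
  exists_blockRayLevel_subset σ hJ (wittBlockOn e (Finset.univ.erase α)) (monotone_wittBlockOn_of_std e hstd _)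
    ((Valuation.ne_zero_iff _).2 (Units.ne_zero ϖ)) hϖ hγ0 hγ _ _ (coe_wittCocharacter_eq_glDiagonal σ e hσ Han ϖ α)
    (fun i j _ hc => valuation_wittCoweight_ratio_le_of_label_lt σ α ϖ hϖ.le hσϖ e i j hc) hO

/-! ## §3 Harish-Chandra's criterion over the Witt cone, modulo the Cartan decomposition -/

include hstd hJ hϖ hσϖ in
/-- **HARISH-CHANDRA'S CRITERION ⇐ FOR THE QUASI-SPLIT `U(σ, Φ_N)(K)` OVER THE WITT CONE** (any Witt index `r`, `Φ_N = wittFormOn e Han` in a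
standard indexing, `K` a non-archimedean local field, `σ` a continuous involution with `|σ ϖ| = |ϖ|`, `0 < |ϖ| < 1`).  IF the Cartan decomposition
`U = K₀ · {∏_α a_α(ϖ)^{n_α} : n ∈ ℕ^r} · K₀ · Z(U)` holds (`K₀ = U ∩ GL_N(𝒪)`, hypothesis `hcartan`), THEN every smooth representation of `U` whose
Jacquet modules along the `r` maximal standard parabolics `P_{univ ∖ {α}}` vanish is supercuspidal: the tree's ★
`Representation.isSupercuspidal_of_subsingleton_coinvariants_of_cartan_pi` fed with §2 and ★ `AnyRank.isCompact_comap_glInt`.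
[cite: Casselman1995, Thm. 5.3.1] [cite: BernsteinZelevinsky1976, Thm. 3.21] [cite: HarishChandra1970, Part I §3] -/
theorem isSupercuspidal_of_subsingleton_coinvariants_of_wittCartan (hσc : Continuous σ) {V : Type*} [AddCommGroup V] [Module ℂ V]
    (ρ : Representation ℂ ↥(unitaryGroupOfForm σ (wittFormOn e Han)) V) (hρ : ρ.IsSmooth)
    (h : ∀ α : Fin r, Subsingleton ((standardParabolicTriple σ e Han (Finset.univ.erase α)).restrict ρ).Coinvariants)
    (hcartan : ∀ g : ↥(unitaryGroupOfForm σ (wittFormOn e Han)),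
      ∃ k₁ ∈ (glInt N K).comap (unitaryGroupOfForm σ (wittFormOn e Han)).subtype,
      ∃ k₂ ∈ (glInt N K).comap (unitaryGroupOfForm σ (wittFormOn e Han)).subtype, ∃ n : Fin r → ℕ,
      ∃ z ∈ Subgroup.center ↥(unitaryGroupOfForm σ (wittFormOn e Han)),
        g = k₁ * Finset.univ.noncommProd (fun α => wittCocharacter σ hσ e Han α ϖ ^ n α)
          (fun α _ β _ _ => (commute_wittCocharacter σ e hσ Han α β ϖ ϖ).pow_pow (n α) (n β)) * k₂ * z) :
    ρ.IsSupercuspidal :=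
  ρ.isSupercuspidal_of_subsingleton_coinvariants_of_cartan_pi hρ (fun α => standardParabolicTriple σ e Han (Finset.univ.erase α)) h
    (fun α j => ((congruenceGL N (valuation K (ϖ : K))).comap (unitaryGroupOfForm σ (wittFormOn e Han)).subtype ⊓
        (borelTriple σ (wittFormOn e Han) hJ).N ⊓
        (unipotentRadicalGL K (wittBlockOn e (Finset.univ.erase α))).comap (unitaryGroupOfForm σ (wittFormOn e Han)).subtype).map
        (MulAut.conj (wittCocharacter σ hσ e Han α ϖ ^ (-j))).toMonoidHom)
    (fun α j => wittRayLevel_mono σ hσ e hstd Han hJ ϖ hϖ.le hσϖ hϖ α j)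
    (fun α _ hu => exists_mem_wittRayLevel σ hσ e hstd Han hJ ϖ hϖ hσϖ ((Valuation.ne_zero_iff _).2 (Units.ne_zero ϖ)) hϖ α hu)
    (fun α _ hO => exists_wittRayLevel_subset σ hσ e hstd Han hJ ϖ hϖ hσϖ ((Valuation.ne_zero_iff _).2 (Units.ne_zero ϖ)) hϖ α hO)
    (fun α => wittCocharacter σ hσ e Han α ϖ) (fun α β => commute_wittCocharacter σ e hσ Han α β ϖ ϖ)
    (fun α j _ hu => conj_mem_wittRayLevel σ hσ e Han hJ ϖ α j hu)
    (fun α β j _ hu => conj_mem_wittRayLevel_of_commute σ hσ e hstd Han hJ ϖ hϖ.le hσϖ hϖ α β j hu)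
    ((glInt N K).comap (unitaryGroupOfForm σ (wittFormOn e Han)).subtype) (AnyRank.isCompact_comap_glInt σ hσc) hcartan

end RayTop

end Summit.HodgeConjecture.HodgeConjecture.Cruxes.H413.K2E3WittConeContraction
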